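import Literature.IUT.HodgeTheaters.ConventionsTemperoids
import Literature.AnabelianGeometry.SemiGraphs.TemperedGroupsLimit
import Literature.AnabelianGeometry.SemiGraphs.Temperoids
import Literature.AnabelianGeometry.SemiGraphs.GaloisCountable
import HarnessLib

/-!
# [IUTchI] §0 "Numbers / Temperoids" conventions ↔ [SemiAnbd] §3: the bridge, PROOFS

Mochizuki, *Inter-universal Teichmüller theory I: construction of Hodge theaters*, kurims
manuscript (May 2020), §0 "Notations and Conventions", pp. 34–35 [cite: Mochizuki2012, §0 pp.34-35]
(D-0012 claim key; series status DISPUTED — but nothing on this page is contested: §0 only RECALLS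
[SemiAnbd] §3, Mochizuki, *Semi-graphs of anabelioids*, Publ. RIMS 42 (2006), Def. 3.1).

PROOF-ONLY bridge (no definitions) between the two transcriptions of the same printed definitions
that the cell abc-iut holds:
* `Literature.IUT.HodgeTheaters.*` (`ConventionsTemperoids.lean`, seat abc-iut-L5-t1): the PRINTED
  form — `SurjectiveSystem`, `IsTempered G := ∃ S, G ≃ₜ* lim S`, `bTempProperty`/`BTemp`/`BTemp.res`,
  `IsGaloisCountable`, `IsConnectedTemperoid`, `IsGaloisCountableTemperoid`,
  `IsTemperoidMorphismFunctor`/`TemperoidHom` (iso-classes of functors);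
* `Literature.AnabelianGeometry.SemiGraphs.*` (`TemperedGroups.lean`, `TemperedGroupsLimit.lean`,
  `Temperoids.lean`, `GaloisCountable.lean`, seat abc-iut-L3-t2): the INTRINSIC form `IsTempered`
  (proved equivalent to the printed form there: `isTempered_iff_nonempty_limitPresentation`),
  `temperedAction`/`BTemp`/`BTemp.res`, `ConnectedTemperoidChart`/`IsConnectedTemperoid`,
  `TemperoidHom` (functors), `IsGaloisCountable`.
This is the merge asked for by the L3-lead ruling δ1′/δ2/δ3 (cell INBOX 2026-08-25T18:46:41Z),
carried out WITHOUT touching the frozen statement files: every [IUTchI] §0 notion is identified with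
(or characterised through) its [SemiAnbd] §3 counterpart, so that consumers may pass between the two
vocabularies by name.

Contents: `bTempProperty_eq_temperedAction`, `bTemp_eq_semiGraphs`, `bTempRes_eq_semiGraphs`
(definitional equalities); `SurjectiveSystem.exists_continuousMulEquiv_limit` /
`exists_surjectiveSystem_continuousMulEquiv_limit` (the two kinds of inverse systems have the same
limits); `isTempered_iff_semiGraphs`; `isGaloisCountable_iff_semiGraphs`;
`isConnectedTemperoid_iff_semiGraphs`, `isGaloisCountableTemperoid_iff_semiGraphs` (at the universe
level the [IUTchI] file types them: `Π`-sets in the universe of the hom-sets);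
`isTemperoidMorphismFunctor_iff_semiGraphs`, `TemperoidHom.exists_mk_eq` (δ3: an [IUTchI] §0
morphism of connected temperoids is exactly the isomorphism class of a [SemiAnbd] Def. 3.1 (iii)
morphism).  No statement of either paper is strengthened; nothing here bears on any disputed claim.
-/

namespace Literature.IUT.HodgeTheaters

open CategoryTheory
open scoped _root_.Topology
open Literature.AnabelianGeometry

universe w v u

/-! ### `B^temp(Π)` and pull-back: definitional agreement -/

section BTemp

variable (G : Type u) [Group G] [TopologicalSpace G]

/-- The object property cutting out `B^temp(Π)` ([IUTchI] §0 p. 34) IS the one of [SemiAnbd] §3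
p. 33 (`SemiGraphs.temperedAction`): countable underlying set, open stabilisers.
[cite: Mochizuki2012, §0 p.34] -/
theorem bTempProperty_eq_temperedAction : bTempProperty.{u} G = SemiGraphs.temperedAction G := rfl

/-- `B^temp(Π)` of [IUTchI] §0 p. 34 (with `Π`-sets in the universe of `Π`) IS the category
`SemiGraphs.BTemp Π` of [SemiAnbd] §3 p. 33. [cite: Mochizuki2012, §0 p.34] -/
theorem bTemp_eq_semiGraphs : BTemp.{u} G = SemiGraphs.BTemp G := rfl

variable {G} {H : Type u} [Group H] [TopologicalSpace H]

/-- The pull-back functor `f^* : B^temp(Π₂) → B^temp(Π₁)` of a continuous homomorphism ([IUTchI] §0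
p. 35, (a) → (b)) IS the restriction functor `SemiGraphs.BTemp.res` of [SemiAnbd] Rmk. 3.1.2.
[cite: Mochizuki2012, §0 p.35] -/
theorem bTempRes_eq_semiGraphs (f : G →* H) (hf : Continuous f) :
    (BTemp.res f hf : BTemp.{u} H ⥤ BTemp.{u} G) =
      SemiGraphs.BTemp.res ({ f with continuous_toFun := hf } : G →ₜ* H) := rfl

end BTemp

/-! ### Inverse systems: the two bookkeeping structures have the same limits -/

section Systems

/-- A `SurjectiveSystem` ([IUTchI] §0 p. 34: "an inverse system of surjections of countable discrete
topological groups") is, read field by field, a `SemiGraphs.CountableDiscreteSystem` ([SemiAnbd]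
Def. 3.1 (i)) with the discrete topologies, and the two inverse limits are isomorphic topological
groups (indeed the same subgroup of the same product). [cite: Mochizuki2012, §0 p.34] -/
theorem SurjectiveSystem.exists_continuousMulEquiv_limit (S : SurjectiveSystem.{u}) :
    ∃ S' : SemiGraphs.CountableDiscreteSystem.{u}, Nonempty (S.limit ≃ₜ* S'.limit) := by
  refine
    ⟨{ ι := S.J
       obj := S.obj
       topologicalSpace := fun _ => ⊥
       discreteTopology := fun j => S.instDiscreteTopologyObj j
       countable := fun j => S.countable j
       map := S.map
       map_self := S.map_id
       map_map := S.map_comp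
       map_surjective := S.map_surjective }, ⟨?_⟩⟩
  exact
    { toFun := fun x => ⟨x.1, fun _ _ h => x.2 h⟩
      invFun := fun x => ⟨x.1, fun _ _ h => x.2 h⟩
      left_inv := fun _ => rfl
      right_inv := fun _ => rfl
      map_mul' := fun _ _ => rfl
      continuous_toFun := continuous_induced_rng.2 continuous_subtype_val
      continuous_invFun := continuous_induced_rng.2 continuous_subtype_val }

/-- Conversely a `SemiGraphs.CountableDiscreteSystem` ([SemiAnbd] Def. 3.1 (i)) is a `SurjectiveSystem`
([IUTchI] §0 p. 34) with isomorphic inverse limit (its topologies are the discrete ones).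
[cite: Mochizuki2012, §0 p.34] -/
theorem exists_surjectiveSystem_continuousMulEquiv_limit (S : SemiGraphs.CountableDiscreteSystem.{u}) :
    ∃ S' : SurjectiveSystem.{u}, Nonempty (S.limit ≃ₜ* S'.limit) := by
  obtain ⟨ι, obj, cnt, map, map_self, map_map, map_surj⟩ := S
  rename_i _pre _dir _ne _grp top disc
  -- the topologies ARE the discrete ones: substitute them away
  obtain rfl : top = fun _ => ⊥ := funext fun i => (disc i).eq_bot
  letI tI : ∀ i, TopologicalSpace (obj i) := fun _ => ⊥
  refine
    ⟨{ J := ι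
       obj := obj
       countable := cnt
       map := map
       map_id := map_self
       map_comp := map_map
       map_surjective := map_surj }, ⟨?_⟩⟩
  exact
    { toFun := fun x => ⟨x.1, fun _ _ h => x.2 h⟩
      invFun := fun x => ⟨x.1, fun _ _ h => x.2 h⟩
      left_inv := fun _ => rfl
      right_inv := fun _ => rfl
      map_mul' := fun _ _ => rfl
      continuous_toFun := continuous_induced_rng.2 continuous_subtype_val
      continuous_invFun := continuous_induced_rng.2 continuous_subtype_val }

end Systems

/-! ### Tempered groups -/

section Tempered

variable {G : Type u} [Group G] [TopologicalSpace G]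

/-- [IUTchI] §0 p. 34 "tempered" (printed form: `Π ≅ lim` of surjections of countable discrete
groups) implies [SemiAnbd] Def. 3.1 (i) in the tree's intrinsic form (`SemiGraphs.IsTempered`).
[cite: Mochizuki2012, §0 p.34] -/
theorem IsTempered.semiGraphs (h : IsTempered G) : SemiGraphs.IsTempered G := by
  obtain ⟨S, ⟨e⟩⟩ := h
  obtain ⟨S', ⟨e'⟩⟩ := S.exists_continuousMulEquiv_limit
  exact SemiGraphs.IsTempered.of_limitPresentation S' (e.trans e')

/-- [SemiAnbd] Def. 3.1 (i) (intrinsic form `SemiGraphs.IsTempered`) implies [IUTchI] §0 p. 34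
"tempered" in the printed form, for a topological group (via
`SemiGraphs.IsTempered.limitPresentation`). [cite: Mochizuki2012, §0 p.34] -/
theorem IsTempered.of_semiGraphs [IsTopologicalGroup G] (h : SemiGraphs.IsTempered G) :
    IsTempered G := by
  obtain ⟨S, ⟨e⟩⟩ := h.limitPresentation
  obtain ⟨S', ⟨e'⟩⟩ := exists_surjectiveSystem_continuousMulEquiv_limit S
  exact ⟨S', ⟨e.trans e'⟩⟩

/-- **The two `IsTempered` coincide** ([IUTchI] §0 p. 34 = [SemiAnbd] Def. 3.1 (i)): for a
topological group, `Literature.IUT.HodgeTheaters.IsTempered G ↔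
Literature.AnabelianGeometry.SemiGraphs.IsTempered G`. [cite: Mochizuki2012, §0 p.34] -/
theorem isTempered_iff_semiGraphs [IsTopologicalGroup G] :
    IsTempered G ↔ SemiGraphs.IsTempered G :=
  ⟨IsTempered.semiGraphs, IsTempered.of_semiGraphs⟩

/-- **Galois-countable tempered groups** ([IUTchI] Rmk. 2.5.3 (i) (T1), p. 52, as used in §0 p. 34):
the [IUTchI] file's `IsGaloisCountable G` (tempered ∧ second countable) ↔ the [SemiAnbd]-side
`SemiGraphs.IsTempered G ∧ SemiGraphs.IsGaloisCountable G`.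
[cite: Mochizuki2012, Rmk 2.5.3(i)(T1) p.52] -/
theorem isGaloisCountable_iff_semiGraphs [IsTopologicalGroup G] :
    IsGaloisCountable G ↔ SemiGraphs.IsTempered G ∧ SemiGraphs.IsGaloisCountable G := by
  rw [IsGaloisCountable, isTempered_iff_semiGraphs, SemiGraphs.isGaloisCountable_iff]

end Tempered

/-! ### Connected temperoids -/

section Temperoids

variable (C : Type v) [Category.{u} C]

/-- **Connected temperoids coincide** ([IUTchI] §0 p. 34 = [SemiAnbd] Def. 3.1 (ii)): the [IUTchI]
file's `IsConnectedTemperoid C` (an `∃` over tempered groups `Π` with `C ≌ B^temp(Π)`, `Π`-sets taken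
in the universe of the hom-sets of `C`) ↔ `SemiGraphs.IsConnectedTemperoid C` (a nonempty type of
charts). [cite: Mochizuki2012, §0 p.34] -/
theorem isConnectedTemperoid_iff_semiGraphs :
    IsConnectedTemperoid.{u, v, u} C ↔ SemiGraphs.IsConnectedTemperoid.{u, u, v} C := by
  constructor
  · rintro ⟨G, _, _, _, hG, ⟨e⟩⟩
    exact ⟨{ G := G, isTempered := hG.semiGraphs, equiv := e }⟩
  · rintro ⟨c⟩
    exact ⟨c.G, inferInstance, inferInstance, inferInstance, IsTempered.of_semiGraphs c.isTempered, ⟨c.equiv⟩⟩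

/-- **Galois-countable connected temperoids** ([IUTchI] Rmk. 2.5.3 (i) (T1), p. 52): the [IUTchI]
file's `IsGaloisCountableTemperoid C` ↔ `C` admits a [SemiAnbd]-side chart `C ≌ B^temp(Π)` with `Π`
second countable. [cite: Mochizuki2012, Rmk 2.5.3(i)(T1) p.52] -/
theorem isGaloisCountableTemperoid_iff_semiGraphs :
    IsGaloisCountableTemperoid.{u, v, u} C ↔
      ∃ c : SemiGraphs.ConnectedTemperoidChart.{u, u, v} C, SecondCountableTopology c.G := by
  constructor
  · rintro ⟨G, _, _, _, ⟨hG, hG'⟩, ⟨e⟩⟩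
    exact ⟨{ G := G, isTempered := hG.semiGraphs, equiv := e }, hG'⟩
  · rintro ⟨c, hc⟩
    exact ⟨c.G, inferInstance, inferInstance, inferInstance, ⟨IsTempered.of_semiGraphs c.isTempered, hc⟩,
      ⟨c.equiv⟩⟩

end Temperoids

/-! ### Morphisms of connected temperoids (δ3) -/

section Morphisms

variable {C₁ : Type v} [Category.{w} C₁] {C₂ : Type v} [Category.{w} C₂]

/-- A functor `C₂ ⥤ C₁` underlies an [IUTchI] §0 (p. 35) morphism of connected temperoids
`C₁ → C₂` iff it is the pull-back functor of a [SemiAnbd] Def. 3.1 (iii) morphism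
(`SemiGraphs.TemperoidHom`: preserves finite limits and countable colimits).
[cite: Mochizuki2012, §0 p.35] -/
theorem isTemperoidMorphismFunctor_iff_semiGraphs (F : C₂ ⥤ C₁) :
    IsTemperoidMorphismFunctor F ↔ ∃ φ : SemiGraphs.TemperoidHom C₁ C₂, φ.pullback = F := by
  constructor
  · intro h
    exact ⟨⟨F, h.preservesFiniteLimits, h.preservesCountableColimits⟩, rfl⟩
  · rintro ⟨φ, rfl⟩
    exact ⟨φ.preservesFiniteLimits, φ.preservesCountableColimits⟩

/-- **δ3** ([IUTchI] §0 p. 35: a morphism of connected temperoids is "an isomorphism class of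
functors", which "differs — but only slightly! — from [SemiAnbd] Def. 3.1 (iii)"): every [IUTchI]
morphism `C₁ → C₂` is the class of (the pull-back functor of) a [SemiAnbd] morphism.
[cite: Mochizuki2012, §0 p.35] -/
theorem TemperoidHom.exists_mk_eq (f : TemperoidHom C₁ C₂) :
    ∃ φ : SemiGraphs.TemperoidHom C₁ C₂,
      TemperoidHom.mk φ.pullback ⟨φ.preservesFiniteLimits, φ.preservesCountableColimits⟩ = f := by
  induction f using Quotient.inductionOn with
  | h F => exact ⟨⟨F.1, F.2.preservesFiniteLimits, F.2.preservesCountableColimits⟩, rfl⟩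

/-- Two [SemiAnbd] morphisms define the same [IUTchI] morphism iff their pull-back functors are
isomorphic ([IUTchI] §0 p. 35). [cite: Mochizuki2012, §0 p.35] -/
theorem TemperoidHom.mk_pullback_eq_iff (φ ψ : SemiGraphs.TemperoidHom C₁ C₂) :
    TemperoidHom.mk φ.pullback ⟨φ.preservesFiniteLimits, φ.preservesCountableColimits⟩ =
      TemperoidHom.mk ψ.pullback ⟨ψ.preservesFiniteLimits, ψ.preservesCountableColimits⟩ ↔
      Nonempty (φ.pullback ≅ ψ.pullback) :=
  TemperoidHom.mk_eq_mk_iff _ _ _ _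

end Morphisms

end Literature.IUT.HodgeTheaters
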